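/-
COR-CM (cell pub-hodgecm2) — RSCONJ row Ω (A7, the ω-LABEL face of the μ ↦ μᶜ identification), ROUTE C
(`HOME/d2bridge/ident/ident-1/omega/OMEGA-ROUTE-C.md`): the θ-TWIST `g ↦ ḡ` of the unitary dual-pair Weil carriers is
TRANSPORT OF STRUCTURE along the anti-symplectic involution `Λ : (x, y) ↦ (x, −y)` of `𝕎_𝔸 = 𝔸ⁿ × 𝔸ⁿ`, which the tree
already implements as the relabelling `adelicMpContRelabel (C := −1)` (✔ `Weil1964/AdelicMetaplecticTransport`).
Seat prover-pub-hodgeaudit-ident-1-g3-0 (ident-1 GEN 3), checker ident-2, 2026-08-24.  PART III OF 3 (RecordSystemConjOmegaTwistCarriers).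
KERNEL ONLY: definitions by explicit formula + theorems; no named fact, no instance, no `sorry`.  HC_CM is NOT proved;
HELD — WORLD = C FINAL; nothing displayed by an END is discharged here.
-/
import Summits.HodgeConjecture.CorCM.B01.Transposition.HComp.RecordSystemConjOmegaTwistCompatible
import HarnessLib

set_option autoImplicit false

/-!
# The θ-twist of the unitary dual-pair Weil carriers, III: `ω(s_{−a}; −a; χ⁻¹) ∘ (k ↦ k̄) ≅ ω(s′_a; a; χ)`, ℂ-linearly

Sequel of `RecordSystemConjOmegaTwistCompatible` (Part II: `conjFamily`, `isCompatible_conjFamily`).  For a family `s` of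
[GelbartRogawski1991, Prop. 3.1.1]-compatible splittings at the lines `⟨a⟩` (`hs`) and the transported family `s′ := conjFamily s`
(compatible by `isCompatible_conjFamily`), Liu's carriers `omegaAtLine hs a χ = Coinv (finPairRepW hs_a) (lineChar a χ)`
([Liu2021, Def. 4.11], App. D §D.1 Step 3) compare as follows:

* §1 `finConjV : k ↦ k̄` on `U(J_V)(𝔸_f)` (wb-10 ✔ `finAdelicConj`), `finConjW a : u ↦ ū : U(J_W(a))(𝔸_f) →* U(J_W(−a))(𝔸_f)`
  (`= u⁻¹` on the centre parameter, `finConjW_lineCenterEquiv`), and **`finPairRep_conjFamily`**: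
  `finPairRep (hs′ a) (k, u) = finPairRep (hs (−a)) (k̄, ū)` (Weil's finite factor is `finPart ∘ ω`, and the operators agree).
* §2 `chiInv χ := χ⁻¹` (again automorphic), `lineChar_inv_finConjW` (`χ⁻¹_{W(−a)}(ū) = χ_{W(a)}(u)`), `ker_conjFamily_eq` (the two
  relation submodules of `𝒮((𝔸_F^∞)^{N·1})` COINCIDE), hence **`omegaConjEquiv : omegaAtLine hs′ a χ ≃ₗ[ℂ] omegaAtLine hs (−a) (chiInv χ)`**
  (the identity of `𝒮` descended) and **`omegaConjEquiv_rhoVAtLine`**: it intertwines `rhoVAtLine hs′ a χ k` with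
  `rhoVAtLine hs (−a) χ⁻¹ k̄` — the representation half of RSCONJ row Ω with the CHARACTER LABEL of `s′` left symbolic (no complex
  conjugation, no contragredient; the D_BMM index shape `(·, −ε, χ⁻¹)` along `g ↦ ḡ`).

NOT here: the label `conjFamily (sChiD μ) = sChiD μᶜ` ((C3′), pen mukey-p1) and the model wrapper at `HermSpace3.conj` ((M)).

References: [GelbartRogawski1991] §3.1 p. 454–457; [Weil1964] Chap. I n° 4–5, Chap. III n° 37–41; [MoeglinVignerasWaldspurger1987]
Chap. 2 II.1; [Kudla1996] V.3 (`W⁻`, `Sp(W) = Sp(W⁻)`); [PlatonovRapinchuk1994] §5.1; [Liu2021] Def. 4.11–4.12, Rem. 4.4, App. D §D.1.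
-/

noncomputable section

open scoped Matrix Kronecker
open NumberField IsDedekindDomain
open Literature.RepresentationTheory.HeisenbergGroup
open Literature.NumberTheory.Automorphic Literature.NumberTheory.Automorphic.UnitaryGroup
open Literature.NumberTheory.Weil1964
open Literature.NumberTheory.GelbartRogawski1991 Literature.NumberTheory.GelbartRogawski1991.UnitaryDualPair
open Literature.NumberTheory.GelbartRogawski1991.UnitaryDualPair.WeilCoinv
open Literature.RepresentationTheory
open Literature.NumberTheory.Automorphic.Liu2021.Def411WeilCarriers (TW JW JW_eq isSymm_TW isUnit_det_TW Chi lineChar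
  lineChar_finAdelicCenter lineCenterEquiv lineCenterEquiv_apply IsAutomorphicOneChar omegaAtLine rhoVAtLine)

namespace Summit.HodgeConjecture.CorCM.HComp.OmegaConj

/-! ## §1 (K-d) The carriers: `ω(s′_a; a; χ) ∘ (k ↦ k̄) = ω(s_{−a}; −a; χ⁻¹)` -/

section FiniteConj

variable (F E : Type) [Field F] [NumberField F] [Field E] [NumberField E] [Algebra F E]
variable (c : E ≃ₐ[F] E) (N : ℕ) (JV : Matrix (Fin N) (Fin N) E) {TV : Matrix (Fin N) (Fin N) F}
  (hJV : JV = TV.map (algebraMap F E))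

omit [NumberField F] [NumberField E] in
/-- an `F`-rational matrix is fixed entrywise by `c`. [folklore] -/
theorem map_galConj_of_rational {m : Type*} (T : Matrix m m F) :
    (T.map (algebraMap F E)).map (c : E →+* E) = T.map (algebraMap F E) := by
  rw [Matrix.map_map]
  congr 1
  funext t
  simp only [Function.comp_apply, RingHom.coe_coe, AlgEquiv.commutes]

omit [NumberField F] [NumberField E] in
/-- `c(J_V) = J_V`. [folklore] -/
theorem map_galConj_JV (hJV : JV = TV.map (algebraMap F E)) : JV.map (c : E →+* E) = JV := by
  rw [hJV, map_galConj_of_rational]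

omit [NumberField F] [NumberField E] in
/-- `c(J_W(a)) = J_W(a)`. [folklore] -/
theorem map_galConj_JW (a : Fˣ) : (JW F E a).map (c : E →+* E) = JW F E a := by
  rw [JW, map_galConj_of_rational]

/-- **`k ↦ k̄` on `U(J_V)(𝔸_{F,f})`** (wb-10 ✔ `finAdelicConj` at `c(J_V) = J_V`). [cite: PlatonovRapinchuk1994, §5.1] -/
def finConjV : finAdelic F E c N JV ≃ₜ* finAdelic F E c N JV :=
  Summit.HodgeConjecture.CorCM.D2Bridge.UnitaryGroupConj.finAdelicConj F E c N (map_galConj_JV F E c N JV hJV)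

omit [NumberField F] in
/-- the line groups at `±a` coincide: `U(J_W(−a))(𝔸_{F,f}) = U(J_W(a))(𝔸_{F,f})`. [cite: Kudla1996, V.3] -/
theorem finAdelic_line_neg (a : Fˣ) : finAdelic F E c 1 (JW F E (-a)) = finAdelic F E c 1 (JW F E a) := by
  rw [finAdelic, finAdelic, finiteAdelicForm, finiteAdelicForm, JW_neg,
    Matrix.map_neg _ (map_neg (algebraMap E (FiniteAdeleRing (𝓞 E) E))), unitaryGroupOfForm_neg]

/-- **`u ↦ ū` from `U(J_W(a))(𝔸_{F,f})` to `U(J_W(−a))(𝔸_{F,f})`** (`= u⁻¹` on the norm-one finite ideles). [cite: Kudla1996, V.3] -/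
def finConjW (a : Fˣ) : finAdelic F E c 1 (JW F E a) →* finAdelic F E c 1 (JW F E (-a)) :=
  (MulEquiv.subgroupCongr (finAdelic_line_neg F E c a).symm).toMonoidHom.comp
    (Summit.HodgeConjecture.CorCM.D2Bridge.UnitaryGroupConj.finAdelicConj F E c 1 (map_galConj_JW F E c a)).toMonoidHom

omit [NumberField F] in
/-- underlying matrix of `finConjW a u`: `GL(c ⊗ 1) u`. [folklore] -/
@[simp] theorem coe_finConjW (a : Fˣ) (u : finAdelic F E c 1 (JW F E a)) :
    ((finConjW F E c a u : finAdelic F E c 1 (JW F E (-a))) : GL (Fin 1) (FiniteAdeleRing (𝓞 E) E)) =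
      Matrix.GeneralLinearGroup.map (conjFiniteAdele F E c) u := rfl

omit [NumberField F] in
/-- underlying matrix of `finConjV k`: `GL(c ⊗ 1) k`. [folklore] -/
@[simp] theorem coe_finConjV (k : finAdelic F E c N JV) :
    ((finConjV F E c N JV hJV k : finAdelic F E c N JV) : GL (Fin N) (FiniteAdeleRing (𝓞 E) E)) =
      Matrix.GeneralLinearGroup.map (conjFiniteAdele F E c) k := rfl

omit [NumberField F] in
/-- `(c ⊗ 1)(1, g) = (1, (c ⊗ 1) g)`: conjugation commutes with `GL_m(𝔸_E^∞) → GL_m(𝔸_E)`. [folklore] -/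
theorem map_conjAdele_ofFinite {m : ℕ} (g : GL (Fin m) (FiniteAdeleRing (𝓞 E) E)) :
    Matrix.GeneralLinearGroup.map (conjAdele F E c) (GLn.ofFinite m E g) =
      GLn.ofFinite m E (Matrix.GeneralLinearGroup.map (conjFiniteAdele F E c) g) := by
  refine Units.ext (Matrix.ext fun i j => ?_)
  change conjAdele F E c ((GLn.ofFinite m E g : Matrix (Fin m) (Fin m) (AdeleRing (𝓞 E) E)) i j) =
    (GLn.ofFinite m E (Matrix.GeneralLinearGroup.map (conjFiniteAdele F E c) g) :
      Matrix (Fin m) (Fin m) (AdeleRing (𝓞 E) E)) i j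
  rw [GLn.coe_ofFinite_apply, GLn.coe_ofFinite_apply, conjAdele_apply]
  refine Prod.ext ?_ rfl
  rw [AdeleRing.smul_fst, Matrix.one_apply]
  split_ifs
  · exact smul_one c
  · exact smul_zero c

/-- **`g ↦ ḡ` on finite-adelic pair points**: `ψ(a(1,k) · b(1,u)) = a(1,k̄) · b(1,ū)`.
[cite: PlatonovRapinchuk1994, §5.1] -/
theorem pairConjNeg_inl_mul_inr (a : Fˣ) (k : finAdelic F E c N JV) (u : finAdelic F E c 1 (JW F E a)) :
    pairConjNeg F E c N JV hJV a
        (adelicInl F E c N 1 JV (JW F E a) (finAdelicToAdelic F E c N JV k) *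
          adelicInr F E c N 1 JV (JW F E a) (finAdelicToAdelic F E c 1 (JW F E a) u)) =
      adelicInl F E c N 1 JV (JW F E (-a)) (finAdelicToAdelic F E c N JV (finConjV F E c N JV hJV k)) *
        adelicInr F E c N 1 JV (JW F E (-a)) (finAdelicToAdelic F E c 1 (JW F E (-a)) (finConjW F E c a u)) := by
  refine Subtype.ext (Units.ext ?_)
  change (((adelicInl F E c N 1 JV (JW F E a) (finAdelicToAdelic F E c N JV k) *
      adelicInr F E c N 1 JV (JW F E a) (finAdelicToAdelic F E c 1 (JW F E a) u) : adelicPair F E c N 1 JV (JW F E a)) :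
      GL (Fin N × Fin 1) (AdeleRing (𝓞 E) E)) : Matrix (Fin N × Fin 1) (Fin N × Fin 1) (AdeleRing (𝓞 E) E)).map
        (conjAdele F E c) = _
  rw [Subgroup.coe_mul, Subgroup.coe_mul, Units.val_mul, Units.val_mul, Matrix.map_mul, coe_adelicInl, coe_adelicInr,
    coe_adelicInl, coe_adelicInr, ← kronecker_map_map, ← kronecker_map_map, Matrix.map_one _ (map_zero _) (map_one _),
    Matrix.map_one _ (map_zero _) (map_one _)]
  change ((Matrix.GeneralLinearGroup.map (conjAdele F E c) (GLn.ofFinite N E k) : GL (Fin N) (AdeleRing (𝓞 E) E)) :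
      Matrix (Fin N) (Fin N) (AdeleRing (𝓞 E) E)) ⊗ₖ (1 : Matrix (Fin 1) (Fin 1) (AdeleRing (𝓞 E) E)) *
    ((1 : Matrix (Fin N) (Fin N) (AdeleRing (𝓞 E) E)) ⊗ₖ
      ((Matrix.GeneralLinearGroup.map (conjAdele F E c) (GLn.ofFinite 1 E u) : GL (Fin 1) (AdeleRing (𝓞 E) E)) :
        Matrix (Fin 1) (Fin 1) (AdeleRing (𝓞 E) E))) = _
  rw [map_conjAdele_ofFinite, map_conjAdele_ofFinite]
  rfl

end FiniteConj

section Carriers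

variable (F E : Type) [Field F] [NumberField F] [Field E] [NumberField E] [Algebra F E]
variable (c : E ≃ₐ[F] E) (hc : c * c = 1) (N : ℕ) {n : ℕ} (e : Fin N × Fin 1 ≃ Fin n)
variable (JV : Matrix (Fin N) (Fin N) E) {TV : Matrix (Fin N) (Fin N) F}
variable [Algebra.IsQuadraticExtension F E] {δ : E} (hcδ : c δ = -δ) (hδ : δ ≠ 0) {d : F}
  (hd : δ * δ = algebraMap F E d) (hV : TV.IsSymm) (hVd : IsUnit TV.det) (hJV : JV = TV.map (algebraMap F E))
variable {s : ∀ a : Fˣ, adelicPair F E c N 1 JV (JW F E a) →* adelicMpCont F (Fin n) (adelicGram F e TV (TW F a))}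
  (hs : ∀ a : Fˣ, (splittingDatum F E c N 1 e JV (JW F E a) hcδ hδ hd hV (isSymm_TW F a) hVd (isUnit_det_TW F a) hJV
    (JW_eq F E a)).IsCompatible (s a))

set_option maxHeartbeats 800000 in
-- (two Gram matrices `T_V ⊗ T_W(±a)` in one statement; all arguments of the `rfl`-lemmas are given explicitly so that no
-- higher-order unification through `adelicGram` is attempted)
omit [Algebra.IsQuadraticExtension F E] in
/-- **the Weil operators of the pair at finite-adelic points: `ω(pairSmall s′_a (1,k) (1,u)) = ω(pairSmall s_{−a} (1,k̄) (1,ū))`**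
(`ω ∘ R_a = ω`, `ψ(a(k)b(u)) = a(k̄)b(ū)`, and the reindexing `R_e` is the same on both sides). [cite: MoeglinVignerasWaldspurger1987, Chap. 2 II.1] -/
theorem omega_pairSmall₁_conjFamily (a : Fˣ) (k : finAdelic F E c N JV) (u : finAdelic F E c 1 (JW F E a))
    (Φ : piSchwartzBruhat F (Fin N × Fin 1)) :
    adelicMpCont.omega F (Fin N × Fin 1)
        (TV.map (algebraMap F (AdeleRing (𝓞 F) F)) ⊗ₖ (TW F a).map (algebraMap F (AdeleRing (𝓞 F) F)))
        (pairSmall₁ F E c N 1 e JV (JW F E a) (conjFamily F E c N e JV hJV s a)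
          (finAdelicToAdelic F E c N JV k, finAdelicToAdelic F E c 1 (JW F E a) u)) Φ =
      adelicMpCont.omega F (Fin N × Fin 1)
        (TV.map (algebraMap F (AdeleRing (𝓞 F) F)) ⊗ₖ (TW F (-a)).map (algebraMap F (AdeleRing (𝓞 F) F)))
        (pairSmall₁ F E c N 1 e JV (JW F E (-a)) (s (-a))
          (finAdelicToAdelic F E c N JV (finConjV F E c N JV hJV k),
            finAdelicToAdelic F E c 1 (JW F E (-a)) (finConjW F E c a u))) Φ := by
  rw [omega_pairSmall₁_apply F E c N 1 e JV (JW F E a) (conjFamily F E c N e JV hJV s a),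
    omega_pairSmall₁_apply F E c N 1 e JV (JW F E (-a)) (s (-a)),
    pairRep_apply F E c N 1 e JV (JW F E a) (conjFamily F E c N e JV hJV s a),
    pairRep_apply F E c N 1 e JV (JW F E (-a)) (s (-a))]
  -- `pairSplitting s′ (x, y) = R_a (s_{−a} (ψ (a x · b y)))` definitionally; then `ω ∘ R_a = ω` and `ψ(a x · b y) = a x̄ · b ȳ`
  -- (term mode: no `rw` across the two Gram matrices)
  change (piSBReindex F e).symm (adelicMpCont.omega F (Fin n) (adelicGram F e TV (TW F a))
      (relabelNeg F e TV a (s (-a) (pairConjNeg F E c N JV hJV a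
        (adelicInl F E c N 1 JV (JW F E a) (finAdelicToAdelic F E c N JV k) *
          adelicInr F E c N 1 JV (JW F E a) (finAdelicToAdelic F E c 1 (JW F E a) u))))) (piSBReindex F e Φ)) =
    (piSBReindex F e).symm (adelicMpCont.omega F (Fin n) (adelicGram F e TV (TW F (-a)))
      (s (-a) (adelicInl F E c N 1 JV (JW F E (-a)) (finAdelicToAdelic F E c N JV (finConjV F E c N JV hJV k)) *
          adelicInr F E c N 1 JV (JW F E (-a)) (finAdelicToAdelic F E c 1 (JW F E (-a)) (finConjW F E c a u)))) (piSBReindex F e Φ))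
  exact congrArg (piSBReindex F e).symm
    ((LinearMap.congr_fun (omega_relabelNeg F e a _) _).trans
      (congrArg (fun q => adelicMpCont.omega F (Fin n) (adelicGram F e TV (TW F (-a))) (s (-a) q) (piSBReindex F e Φ))
        (pairConjNeg_inl_mul_inr F E c N JV hJV a k u)))

set_option maxHeartbeats 800000 in
-- (as above; the two sides are `finPart ∘ ω` of the two pair points by `rfl`, written out with explicit Gram matrices)
/-- **(K-d, representation) `finPairRep (hs′ a) (k, u) = finPairRep (hs (−a)) (k̄, ū)`** — the finite Weil representation of
the pair through the transported splitting IS the one through `s_{−a}` precomposed with conjugation (Weil's finite factor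
`finPart ∘ ω`, and the Weil operators agree). [cite: Weil1964, Chap. III n° 37–38 p. 188–190] [cite: Liu2021, App. D §D.1 Step 2 (l. 5219)] -/
theorem finPairRep_conjFamily (a : Fˣ) (k : finAdelic F E c N JV) (u : finAdelic F E c 1 (JW F E a)) :
    finPairRep F E c N 1 e JV (JW F E a) hcδ hδ hd hV (isSymm_TW F a) hVd (isUnit_det_TW F a) hJV (JW_eq F E a)
        (isCompatible_conjFamily F E c N e JV hcδ hδ hd hV hVd hJV s hc hs a) (k, u) =
      finPairRep F E c N 1 e JV (JW F E (-a)) hcδ hδ hd hV (isSymm_TW F (-a)) hVd (isUnit_det_TW F (-a)) hJV (JW_eq F E (-a))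
        (hs (-a)) (finConjV F E c N JV hJV k, finConjW F E c a u) := by
  change finPart F (Fin N × Fin 1) (adelicMpCont.omega F (Fin N × Fin 1)
        (TV.map (algebraMap F (AdeleRing (𝓞 F) F)) ⊗ₖ (TW F a).map (algebraMap F (AdeleRing (𝓞 F) F)))
        (pairSmall₁ F E c N 1 e JV (JW F E a) (conjFamily F E c N e JV hJV s a)
          (finAdelicToAdelic F E c N JV k, finAdelicToAdelic F E c 1 (JW F E a) u))) =
    finPart F (Fin N × Fin 1) (adelicMpCont.omega F (Fin N × Fin 1)
        (TV.map (algebraMap F (AdeleRing (𝓞 F) F)) ⊗ₖ (TW F (-a)).map (algebraMap F (AdeleRing (𝓞 F) F)))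
        (pairSmall₁ F E c N 1 e JV (JW F E (-a)) (s (-a))
          (finAdelicToAdelic F E c N JV (finConjV F E c N JV hJV k),
            finAdelicToAdelic F E c 1 (JW F E (-a)) (finConjW F E c a u))))
  exact congrArg (finPart F (Fin N × Fin 1)) (LinearMap.ext (omega_pairSmall₁_conjFamily F E c N e JV hJV a k u))

/-- **`finPairRepW (hs′ a) u = finPairRepW (hs (−a)) ū`.** [cite: Liu2021, App. D §D.1 Step 3 (l. 5221)] -/
theorem finPairRepW_conjFamily (a : Fˣ) (u : finAdelic F E c 1 (JW F E a)) :
    finPairRepW F E c N 1 e JV (JW F E a) hcδ hδ hd hV (isSymm_TW F a) hVd (isUnit_det_TW F a) hJV (JW_eq F E a)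
        (isCompatible_conjFamily F E c N e JV hcδ hδ hd hV hVd hJV s hc hs a) u =
      finPairRepW F E c N 1 e JV (JW F E (-a)) hcδ hδ hd hV (isSymm_TW F (-a)) hVd (isUnit_det_TW F (-a)) hJV (JW_eq F E (-a))
        (hs (-a)) (finConjW F E c a u) := by
  rw [finPairRepW_apply, finPairRepW_apply, finPairRep_conjFamily F E c hc, map_one]

/-- **`finPairRepV (hs′ a) k = finPairRepV (hs (−a)) k̄`.** [cite: Liu2021, App. D §D.1 Step 2 (l. 5219)] -/
theorem finPairRepV_conjFamily (a : Fˣ) (k : finAdelic F E c N JV) :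
    finPairRepV F E c N 1 e JV (JW F E a) hcδ hδ hd hV (isSymm_TW F a) hVd (isUnit_det_TW F a) hJV (JW_eq F E a)
        (isCompatible_conjFamily F E c N e JV hcδ hδ hd hV hVd hJV s hc hs a) k =
      finPairRepV F E c N 1 e JV (JW F E (-a)) hcδ hδ hd hV (isSymm_TW F (-a)) hVd (isUnit_det_TW F (-a)) hJV (JW_eq F E (-a))
        (hs (-a)) (finConjV F E c N JV hJV k) := by
  rw [finPairRepV_apply, finPairRepV_apply, finPairRep_conjFamily F E c hc, map_one]

end Carriers

/-! ## §2 (K-d) The `χ`-coinvariants: `Ω′ : ω(s′_a; a; χ) ≃ₗ[ℂ] ω(s_{−a}; −a; χ⁻¹)`, equivariant along `k ↦ k̄` -/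

section Coinvariants

variable (F E : Type) [Field F] [NumberField F] [Field E] [NumberField E] [Algebra F E]
variable (c : E ≃ₐ[F] E) (hc : c * c = 1) (N : ℕ) {n : ℕ} (e : Fin N × Fin 1 ≃ Fin n)
variable (JV : Matrix (Fin N) (Fin N) E) {TV : Matrix (Fin N) (Fin N) F}
variable [Algebra.IsQuadraticExtension F E] {δ : E} (hcδ : c δ = -δ) (hδ : δ ≠ 0) {d : F}
  (hd : δ * δ = algebraMap F E d) (hV : TV.IsSymm) (hVd : IsUnit TV.det) (hJV : JV = TV.map (algebraMap F E))
variable {s : ∀ a : Fˣ, adelicPair F E c N 1 JV (JW F E a) →* adelicMpCont F (Fin n) (adelicGram F e TV (TW F a))}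
  (hs : ∀ a : Fˣ, (splittingDatum F E c N 1 e JV (JW F E a) hcδ hδ hd hV (isSymm_TW F a) hVd (isUnit_det_TW F a) hJV
    (JW_eq F E a)).IsCompatible (s a))

omit [NumberField F] [Algebra.IsQuadraticExtension F E] in
/-- **`χ⁻¹` is again an automorphic character of `E¹ \ (𝔸_E^∞)¹`** (D_BMM's `χ′ = χ⁻¹`). [cite: Liu2021, Def. 4.12 (l. 2108–2111)] -/
theorem isAutomorphicOneChar_inv (χ : Chi F E c) :
    IsAutomorphicOneChar F E c (χ.1⁻¹) :=
  ⟨χ.2.1.inv, fun x hx => by rw [MonoidHom.inv_apply, χ.2.2 x hx, inv_one]⟩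

/-- **the index relabelling `χ ↦ χ⁻¹` on `Chi`.** [cite: Liu2021, Def. 4.12 (l. 2108–2111)] -/
def chiInv (χ : Chi F E c) : Chi F E c :=
  ⟨χ.1⁻¹, isAutomorphicOneChar_inv F E c χ⟩

omit [NumberField F] [Algebra.IsQuadraticExtension F E] in
/-- `(chiInv χ).1 = χ.1⁻¹`. [cite: Liu2021, Def. 4.12 (l. 2108–2111)] -/
@[simp] theorem chiInv_val (χ : Chi F E c) : (chiInv F E c χ).1 = χ.1⁻¹ := rfl

omit [NumberField F] [Algebra.IsQuadraticExtension F E] in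
/-- `chiInv` is an involution. [cite: Liu2021, Def. 4.12 (l. 2108–2111)] -/
theorem chiInv_chiInv (χ : Chi F E c) : chiInv F E c (chiInv F E c χ) = χ :=
  Subtype.ext (inv_inv χ.1)

omit [NumberField F] [Algebra.IsQuadraticExtension F E] in
/-- on the norm-one finite ideles `ū = u⁻¹`. [cite: Mok2014, §1 Notation p. 5] -/
theorem conjFiniteAdele_coe_finAdelicOne (z : finAdelicOne F E c) :
    conjFiniteAdele F E c ((z : (FiniteAdeleRing (𝓞 E) E)ˣ) : FiniteAdeleRing (𝓞 E) E) =
      (((z⁻¹ : finAdelicOne F E c) : (FiniteAdeleRing (𝓞 E) E)ˣ) : FiniteAdeleRing (𝓞 E) E) := by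
  rw [Subgroup.coe_inv]
  exact (Units.inv_eq_of_mul_eq_one_left ((mem_finAdelicOne_iff F E c _).1 z.2)).symm

omit [NumberField F] [Algebra.IsQuadraticExtension F E] in
/-- **`ū·1 = u⁻¹·1`**: conjugation on the line group is inversion on the centre parameter:
`finConjW a (u·1_{W(a)}) = u⁻¹·1_{W(−a)}`. [cite: Mok2014, §1 Notation p. 5] -/
theorem finConjW_lineCenterEquiv (a : Fˣ) (z : finAdelicOne F E c) :
    finConjW F E c a (lineCenterEquiv F E c a z) =
      lineCenterEquiv F E c (-a) z⁻¹ := by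
  refine Subtype.ext (Units.ext (Matrix.ext fun i j => ?_))
  change conjFiniteAdele F E c ((((finAdelicCenter F E c 1 (JW F E a) z : finAdelic F E c 1 (JW F E a)) :
      GL (Fin 1) (FiniteAdeleRing (𝓞 E) E)) : Matrix (Fin 1) (Fin 1) (FiniteAdeleRing (𝓞 E) E)) i j) =
    (((finAdelicCenter F E c 1 (JW F E (-a)) z⁻¹ : finAdelic F E c 1 (JW F E (-a))) :
      GL (Fin 1) (FiniteAdeleRing (𝓞 E) E)) : Matrix (Fin 1) (Fin 1) (FiniteAdeleRing (𝓞 E) E)) i j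
  rw [coe_finAdelicCenter, coe_finAdelicCenter, Matrix.smul_apply, Matrix.smul_apply, smul_eq_mul, smul_eq_mul, map_mul,
    conjFiniteAdele_coe_finAdelicOne, Matrix.one_apply]
  split_ifs
  · rw [map_one]
  · rw [map_zero]

omit [NumberField F] [Algebra.IsQuadraticExtension F E] in
/-- **`χ⁻¹_W(−a)(ū) = χ_W(a)(u)`** — the line characters at `±a` correspond under `u ↦ ū` with `χ ↦ χ⁻¹`.
[cite: Liu2021, App. D §D.1 Step 3 (l. 5221), Def. 4.12 (l. 2108–2111)] -/
theorem lineChar_inv_finConjW (a : Fˣ) (χ : finAdelicOne F E c →* ℂˣ) (u : finAdelic F E c 1 (JW F E a)) :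
    lineChar F E c (-a) χ⁻¹ (finConjW F E c a u) = lineChar F E c a χ u := by
  obtain ⟨z, rfl⟩ := (lineCenterEquiv F E c a).surjective u
  rw [finConjW_lineCenterEquiv, lineCenterEquiv_apply,
    lineCenterEquiv_apply, lineChar_finAdelicCenter,
    lineChar_finAdelicCenter, MonoidHom.inv_apply, map_inv, inv_inv]

omit [NumberField F] [Algebra.IsQuadraticExtension F E] in
/-- `u ↦ ū` is onto the line group at `−a` (`ū·1 = u⁻¹·1` and the centre map is onto). [cite: Mok2014, §1 Notation p. 5] -/
theorem finConjW_surjective (a : Fˣ) : Function.Surjective (finConjW F E c a) := by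
  intro u'
  obtain ⟨z, rfl⟩ := (lineCenterEquiv F E c (-a)).surjective u'
  exact ⟨lineCenterEquiv F E c a z⁻¹, by
    rw [finConjW_lineCenterEquiv, inv_inv]⟩

/-- **the relation submodules of the two coinvariant spaces COINCIDE** inside `𝒮((𝔸_F^∞)^{N·1})`:
`span {ω_f(s′_a)(1,u) f − χ_W(a)(u) f} = span {ω_f(s_{−a})(1,u′) f − χ⁻¹_W(−a)(u′) f}` — the generators correspond under the
bijection `u ↦ ū`. [cite: Liu2021, App. D §D.1 Step 3 (l. 5221)] -/
theorem ker_conjFamily_eq (a : Fˣ) (χ : Chi F E c) :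
    TwistedCoinv.ker
        (finPairRepW F E c N 1 e JV (JW F E a) hcδ hδ hd hV (isSymm_TW F a) hVd (isUnit_det_TW F a) hJV (JW_eq F E a)
          (isCompatible_conjFamily F E c N e JV hcδ hδ hd hV hVd hJV s hc hs a))
        (lineChar F E c a χ.1) =
      TwistedCoinv.ker
        (finPairRepW F E c N 1 e JV (JW F E (-a)) hcδ hδ hd hV (isSymm_TW F (-a)) hVd (isUnit_det_TW F (-a)) hJV
          (JW_eq F E (-a)) (hs (-a)))
        (lineChar F E c (-a) (chiInv F E c χ).1) := by
  unfold TwistedCoinv.ker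
  congr 1
  ext f
  constructor
  · rintro ⟨⟨u, v⟩, rfl⟩
    refine ⟨⟨finConjW F E c a u, v⟩, ?_⟩
    simp only [chiInv_val]
    rw [← finPairRepW_conjFamily F E c hc N e JV hcδ hδ hd hV hVd hJV hs a u, lineChar_inv_finConjW]
  · rintro ⟨⟨u', v⟩, rfl⟩
    obtain ⟨u, rfl⟩ := finConjW_surjective F E c a u'
    refine ⟨⟨u, v⟩, ?_⟩
    simp only [chiInv_val]
    rw [← finPairRepW_conjFamily F E c hc N e JV hcδ hδ hd hV hVd hJV hs a u, lineChar_inv_finConjW]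

/-- **`Ω′ : ω(s′_a; a; χ) ≃ₗ[ℂ] ω(s_{−a}; −a; χ⁻¹)`** — the `ℂ`-LINEAR identification of Liu's carrier at the line `⟨a⟩` through the
transported splitting `s′_a` with the carrier at `⟨−a⟩` through `s_{−a}` at the inverse character: the identity of
`𝒮((𝔸_F^∞)^{3})` descended to the two (equal) quotients.  No complex conjugation, no contragredient.
[cite: Liu2021, Def. 4.11 (l. 2092–2096), Def. 4.12 (l. 2108–2111), App. D Lem. D.1 (2) (l. 5231)] [cite: Kudla1996, V.3] -/
def omegaConjEquiv (a : Fˣ) (χ : Chi F E c) :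
    omegaAtLine F E c N e JV hcδ hδ hd hV hVd hJV (isCompatible_conjFamily F E c N e JV hcδ hδ hd hV hVd hJV s hc hs) a χ ≃ₗ[ℂ]
      omegaAtLine F E c N e JV hcδ hδ hd hV hVd hJV hs (-a) (chiInv F E c χ) :=
  Submodule.quotEquivOfEq _ _ (ker_conjFamily_eq F E c hc N e JV hcδ hδ hd hV hVd hJV hs a χ)

/-- `Ω′` on classes: `Ω′ [f] = [f]`. [cite: Liu2021, Def. 4.11 (l. 2092–2096)] -/
theorem omegaConjEquiv_mk (a : Fˣ) (χ : Chi F E c) (f : FinSB F (Fin N × Fin 1)) :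
    omegaConjEquiv F E c hc N e JV hcδ hδ hd hV hVd hJV hs a χ (TwistedCoinv.mk _ _ f) = TwistedCoinv.mk _ _ f :=
  Submodule.quotEquivOfEq_mk _ _ _ f

/-- **EQUIVARIANCE ALONG `k ↦ k̄`**: `Ω′ (ω(s′_a; a; χ)(k) x) = ω(s_{−a}; −a; χ⁻¹)(k̄) (Ω′ x)` for all `k ∈ U(J_V)(𝔸_{F,f})` —
`Ω′` intertwines Liu's `U(J_V)`-action at `⟨a⟩` through `s′` with the action at `⟨−a⟩` through `s_{−a}` PRECOMPOSED WITH
ENTRYWISE CONJUGATION: **`ω(s_{−a}; −a; χ⁻¹) ∘ θ ≅ ω(s′_a; a; χ)`** as representations of `U(J_V)(𝔸_{F,f})`, linearly.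
[cite: Liu2021, Def. 4.11 (l. 2092–2096), Rem. 4.4 (l. 1912–1930), App. D Lem. D.1 (2) (l. 5231)] [cite: MoeglinVignerasWaldspurger1987, Chap. 2 II.1] -/
theorem omegaConjEquiv_rhoVAtLine (a : Fˣ) (χ : Chi F E c) (k : finAdelic F E c N JV)
    (x : omegaAtLine F E c N e JV hcδ hδ hd hV hVd hJV (isCompatible_conjFamily F E c N e JV hcδ hδ hd hV hVd hJV s hc hs) a χ) :
    omegaConjEquiv F E c hc N e JV hcδ hδ hd hV hVd hJV hs a χ
        (rhoVAtLine F E c N e JV hcδ hδ hd hV hVd hJV (isCompatible_conjFamily F E c N e JV hcδ hδ hd hV hVd hJV s hc hs) a χ k x) =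
      rhoVAtLine F E c N e JV hcδ hδ hd hV hVd hJV hs (-a) (chiInv F E c χ) (finConjV F E c N JV hJV k)
        (omegaConjEquiv F E c hc N e JV hcδ hδ hd hV hVd hJV hs a χ x) := by
  obtain ⟨f, rfl⟩ := TwistedCoinv.mk_surjective _ _ x
  rw [rhoVAtLine, weilCoinv_mk, omegaConjEquiv_mk, omegaConjEquiv_mk, rhoVAtLine, weilCoinv_mk,
    ← finPairRepV_apply, ← finPairRepV_apply, finPairRepV_conjFamily F E c hc N e JV hcδ hδ hd hV hVd hJV hs]

end Coinvariants

end Summit.HodgeConjecture.CorCM.HComp.OmegaConj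

end
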